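import Literature.AlgebraicTopology.Homotopy.SquareUnfold
import Mathlib.Topology.Homotopy.HomotopyGroup
import HarnessLib

/-!
# Faces of singular cubes and planar moves on pairs of coordinates

Topic `Literature/AlgebraicTopology/Homotopy`. Bookkeeping on Mathlib's cubes `Iᴺ = Fin N → I`
and generalized loops `Ω^ (Fin N) X x` (`Mathlib/Topology/Homotopy/HomotopyGroup.lean`) for the
cubical homotopy addition theorem (`CubicalHomotopyAddition.lean`; Hatcher, *Algebraic Topology*
(2002), §4.1, pp. 340–341, the cube calculus behind `f + g` in `πₙ`):

* `pairMap a b θ` — the self-map of `Iᴺ` acting by a map `θ : I × I → I × I` on the two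
  coordinates `a ≠ b` and identically on the others; its coordinates, continuity (also jointly in a
  parameter), and `pairMap_mem_boundary`: it preserves `∂Iᴺ` when `θ` preserves `∂I²`;
* `precompPair f …` — the generalized loop `f ∘ pairMap a b θ`, and
  **`mk_precompPair_eq`**: its class in `π_N(X, x)` equals `⟦f⟧` whenever `θ = Θ 1` for a family
  `Θ` of boundary-preserving maps of the square with `Θ 0 = id` (the homotopy
  `t ↦ f ∘ pairMap a b (Θ t)` is rel `∂Iᴺ`);
* `cubeFace g j ε = g ∘ Fin.insertNth j ε` — the face `{y_j = ε}` of a singular cube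
  `g : Iᴺ⁺¹ → X`; `IsSkelConst g x` — `g` is constant `= x` on the points of `Iᴺ⁺¹` with two
  coordinates in `{0, 1}` (the codimension-two skeleton), under which every face is a generalized
  loop `faceLoop g hg j ε : Ω^ (Fin N) X x`;
* `pairMap_insertNth` — a pair move on `Iᴺ⁺¹` in coordinates `j.succAbove a`, `j.succAbove b`
  restricts on the face `{y_j = ε}` to the pair move in coordinates `a`, `b`, whence
  `faceClass_precomp_pairMap`: such faces of `g ∘ pairMap … (Θ 1)` and of `g` have the same class
  (`faceClass g hg j ε hε : HomotopyGroup (Fin N) X x`, the class of the face).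

Everything is elementary and proved; `[folklore]`.

## References

* A. Hatcher, *Algebraic Topology*, CUP (2002), §4.1, pp. 340–341. [HatcherAT2002]
-/

noncomputable section

open scoped unitInterval Topology Topology.Homotopy
open Set Function

universe u

namespace Literature.AlgebraicTopology.Homotopy

namespace CubeHAT

open SquareUnfold (sqBoundary)

variable {N : ℕ} {X : Type u} [TopologicalSpace X] {x : X}

/-! ### Pair moves -/

/-- **The pair move** of `Iᴺ` by `θ : I × I → I × I` in the coordinates `a`, `b`:
`y ↦ y` with `(y_a, y_b)` replaced by `θ (y_a, y_b)`. [folklore] -/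
def pairMap (a b : Fin N) (θ : I × I → I × I) (y : Fin N → I) : Fin N → I :=
  update (update y a (θ (y a, y b)).1) b (θ (y a, y b)).2

variable {a b : Fin N} {θ : I × I → I × I}

/-- The `b`-coordinate of a pair move. [folklore] -/
@[simp] lemma pairMap_apply_snd (y : Fin N → I) : pairMap a b θ y b = (θ (y a, y b)).2 := by
  simp [pairMap]

/-- The `a`-coordinate of a pair move (`a ≠ b`). [folklore] -/
lemma pairMap_apply_fst (hab : a ≠ b) (y : Fin N → I) : pairMap a b θ y a = (θ (y a, y b)).1 := by
  simp [pairMap, update_of_ne hab]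

/-- The other coordinates are unchanged by a pair move. [folklore] -/
lemma pairMap_apply_of_ne {j : Fin N} (hja : j ≠ a) (hjb : j ≠ b) (y : Fin N → I) :
    pairMap a b θ y j = y j := by
  simp [pairMap, update_of_ne hja, update_of_ne hjb]

/-- A pair move fixes the points where `θ` fixes the pair of coordinates. [folklore] -/
lemma pairMap_eq_self_of {y : Fin N → I} (h : θ (y a, y b) = (y a, y b)) : pairMap a b θ y = y := by
  simp [pairMap, h]

/-- A pair move by a continuous `θ` is continuous. [folklore] -/
lemma continuous_pairMap (hθ : Continuous θ) : Continuous (pairMap a b θ) := by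
  unfold pairMap
  fun_prop

/-- Joint continuity of a pair move by a continuous family `Θ`. [folklore] -/
lemma continuous_pairMap₂ {Θ : I → I × I → I × I} (hΘ : Continuous fun q : I × (I × I) => Θ q.1 q.2) :
    Continuous fun q : I × (Fin N → I) => pairMap a b (Θ q.1) q.2 := by
  unfold pairMap
  have h : Continuous fun q : I × (Fin N → I) => Θ q.1 (q.2 a, q.2 b) :=
    hΘ.comp (continuous_fst.prodMk ((continuous_apply a).comp continuous_snd |>.prodMk
      ((continuous_apply b).comp continuous_snd)))
  fun_prop

/-- **A pair move by a boundary-preserving `θ` preserves `∂Iᴺ`.** [folklore] -/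
theorem pairMap_mem_boundary (hab : a ≠ b) (hθ : MapsTo θ sqBoundary sqBoundary) {y : Fin N → I}
    (hy : y ∈ Cube.boundary (Fin N)) : pairMap a b θ y ∈ Cube.boundary (Fin N) := by
  obtain ⟨i, hi⟩ := hy
  by_cases hia : i = a
  · subst hia
    have hm : θ (y i, y b) ∈ sqBoundary := hθ (by rcases hi with h | h <;> simp [sqBoundary, h])
    rcases hm with h | h | h | h
    · exact ⟨i, Or.inl (by rw [pairMap_apply_fst hab, h])⟩
    · exact ⟨i, Or.inr (by rw [pairMap_apply_fst hab, h])⟩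
    · exact ⟨b, Or.inl (by rw [pairMap_apply_snd, h])⟩
    · exact ⟨b, Or.inr (by rw [pairMap_apply_snd, h])⟩
  by_cases hib : i = b
  · subst hib
    have hm : θ (y a, y i) ∈ sqBoundary := hθ (by rcases hi with h | h <;> simp [sqBoundary, h])
    rcases hm with h | h | h | h
    · exact ⟨a, Or.inl (by rw [pairMap_apply_fst hab, h])⟩
    · exact ⟨a, Or.inr (by rw [pairMap_apply_fst hab, h])⟩
    · exact ⟨i, Or.inl (by rw [pairMap_apply_snd, h])⟩
    · exact ⟨i, Or.inr (by rw [pairMap_apply_snd, h])⟩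
  · exact ⟨i, by rw [pairMap_apply_of_ne hia hib]; exact hi⟩

/-! ### Precomposing generalized loops with pair moves -/

variable (a b θ) in
/-- **The generalized loop `f ∘ pairMap a b θ`** for a boundary-preserving continuous `θ`.
[folklore] -/
def precompPair (f : Ω^ (Fin N) X x) (hab : a ≠ b) (hθc : Continuous θ)
    (hθb : MapsTo θ sqBoundary sqBoundary) : Ω^ (Fin N) X x :=
  ⟨(f : C(Fin N → I, X)).comp ⟨pairMap a b θ, continuous_pairMap hθc⟩,
    fun _ hy => f.2 _ (pairMap_mem_boundary hab hθb hy)⟩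

/-- `precompPair` pointwise. [folklore] -/
@[simp] lemma precompPair_apply (f : Ω^ (Fin N) X x) (hab : a ≠ b) (hθc : Continuous θ)
    (hθb : MapsTo θ sqBoundary sqBoundary) (y : Fin N → I) :
    precompPair a b θ f hab hθc hθb y = f (pairMap a b θ y) := rfl

/-- **Precomposition with the end of a boundary-preserving deformation of the square does not
change the class**: if `Θ 0 = id`, every `Θ t` preserves `∂I²` and `(t, p) ↦ Θ t p` is continuous,
then `⟦f ∘ pairMap a b (Θ 1)⟧ = ⟦f⟧` in `π_N(X, x)` — the homotopy `t ↦ f ∘ pairMap a b (Θ t)` is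
rel `∂Iᴺ` (Hatcher 2002, §4.1: homotopies through maps `(Iⁿ, ∂Iⁿ) → (X, x₀)`). [folklore] -/
theorem mk_precompPair_eq (f : Ω^ (Fin N) X x) (hab : a ≠ b) {Θ : I → I × I → I × I}
    (hΘc : Continuous fun q : I × (I × I) => Θ q.1 q.2) (h0 : ∀ p, Θ 0 p = p)
    (hΘb : ∀ t, MapsTo (Θ t) sqBoundary sqBoundary) :
    (⟦precompPair a b (Θ 1) f hab
        (hΘc.comp (Continuous.prodMk continuous_const continuous_id)) (hΘb 1)⟧ :
      HomotopyGroup (Fin N) X x) = ⟦f⟧ := by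
  refine Quotient.sound ⟨{
    toFun := fun q => f (pairMap a b (Θ (σ q.1)) q.2)
    continuous_toFun := (f : C(Fin N → I, X)).continuous.comp
      ((continuous_pairMap₂ hΘc).comp
        ((unitInterval.continuous_symm.comp continuous_fst).prodMk continuous_snd))
    map_zero_left := fun y => by simp
    map_one_left := fun y => by
      change f (pairMap a b (Θ (σ 1)) y) = f y
      rw [unitInterval.symm_one, pairMap_eq_self_of (h0 _)]
    prop' := fun t y hy => by
      change f (pairMap a b (Θ (σ t)) y) = precompPair a b (Θ 1) f hab _ (hΘb 1) y
      rw [precompPair_apply, GenLoop.boundary f _ (pairMap_mem_boundary hab (hΘb _) hy),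
        GenLoop.boundary f _ (pairMap_mem_boundary hab (hΘb 1) hy)] }⟩

/-! ### Faces of singular cubes -/

/-- The inclusion `Iᴺ → Iᴺ⁺¹` of the face `{y_j = ε}`, `t ↦ Fin.insertNth j ε t`, as a continuous
map. [folklore] -/
def faceIncl (j : Fin (N + 1)) (ε : I) : C(Fin N → I, Fin (N + 1) → I) :=
  ⟨fun t => Fin.insertNth j ε t, by fun_prop⟩

/-- `faceIncl` pointwise. [folklore] -/
@[simp] lemma faceIncl_apply (j : Fin (N + 1)) (ε : I) (t : Fin N → I) :
    faceIncl j ε t = Fin.insertNth j ε t := rfl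

/-- **The face `{y_j = ε}` of a singular cube** `g : Iᴺ⁺¹ → X`: `g ∘ Fin.insertNth j ε` (for
`j = 0` and `ε = 0, 1` these are the two ends of `g` read as a homotopy; Hatcher 2002, §4.1).
[folklore] -/
def cubeFace (g : C(Fin (N + 1) → I, X)) (j : Fin (N + 1)) (ε : I) : C(Fin N → I, X) :=
  g.comp (faceIncl j ε)

/-- `cubeFace` pointwise. [folklore] -/
@[simp] lemma cubeFace_apply (g : C(Fin (N + 1) → I, X)) (j : Fin (N + 1)) (ε : I) (t : Fin N → I) :
    cubeFace g j ε t = g (Fin.insertNth j ε t) := rfl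

/-- A coordinate of the cube is extreme: `0` or `1`. [folklore] -/
def IsExtreme (c : I) : Prop := c = 0 ∨ c = 1

/-- `0` is extreme. [folklore] -/
lemma isExtreme_zero : IsExtreme 0 := Or.inl rfl

/-- `1` is extreme. [folklore] -/
lemma isExtreme_one : IsExtreme 1 := Or.inr rfl

variable (x) in
/-- **`g` is constant `= x` on the codimension-two skeleton of the cube**: at every point with two
distinct extreme coordinates. Equivalently: every face `cubeFace g j ε` (`ε = 0, 1`) sends `∂Iᴺ`
to `x`, i.e. is a generalized loop at `x`. [folklore] -/
def IsSkelConst (g : C(Fin (N + 1) → I, X)) : Prop :=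
  ∀ (y : Fin (N + 1) → I) (i j : Fin (N + 1)), i ≠ j → IsExtreme (y i) → IsExtreme (y j) → g y = x

/-- Under `IsSkelConst`, a face with extreme level `ε` sends `∂Iᴺ` to `x`. [folklore] -/
lemma cubeFace_apply_of_mem_boundary {g : C(Fin (N + 1) → I, X)} (hg : IsSkelConst x g)
    (j : Fin (N + 1)) {ε : I} (hε : IsExtreme ε) {t : Fin N → I} (ht : t ∈ Cube.boundary (Fin N)) :
    cubeFace g j ε t = x := by
  obtain ⟨i, hi⟩ := ht
  rw [cubeFace_apply]
  refine hg _ j (j.succAbove i) (Fin.ne_succAbove j i) ?_ ?_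
  · rw [Fin.insertNth_apply_same]; exact hε
  · rw [Fin.insertNth_apply_succAbove]; exact hi

/-- **The face `{y_j = ε}` (`ε = 0, 1`) of a cube constant on the codimension-two skeleton, as a
generalized loop at `x`.** [folklore] -/
def faceLoop (g : C(Fin (N + 1) → I, X)) (hg : IsSkelConst x g) (j : Fin (N + 1)) (ε : I)
    (hε : IsExtreme ε) : Ω^ (Fin N) X x :=
  ⟨cubeFace g j ε, fun _ ht => cubeFace_apply_of_mem_boundary hg j hε ht⟩

/-- `faceLoop` pointwise. [folklore] -/
@[simp] lemma faceLoop_apply (g : C(Fin (N + 1) → I, X)) (hg : IsSkelConst x g) (j : Fin (N + 1))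
    (ε : I) (hε : IsExtreme ε) (t : Fin N → I) : faceLoop g hg j ε hε t = g (Fin.insertNth j ε t) := rfl

/-- Generalized loops with the same values are equal (and so are their classes). [folklore] -/
lemma genLoop_eq_of_forall {p q : Ω^ (Fin N) X x} (h : ∀ t, p t = q t) : p = q :=
  Subtype.ext (ContinuousMap.ext h)

/-- The class of a generalized loop in `π_N(X, x)`, as a definition with values in
`HomotopyGroup (Fin N) X x` (so that the group operations of `π_N` apply to it directly; cf. the
TODO "introduce `HomotopyGroup.mk`" in Mathlib's `HomotopyGroup.mul_spec`). [folklore] -/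
def cls (p : Ω^ (Fin N) X x) : HomotopyGroup (Fin N) X x := ⟦p⟧

/-- `cls p` is `⟦p⟧`. [folklore] -/
lemma cls_eq (p : Ω^ (Fin N) X x) : cls p = ⟦p⟧ := rfl

/-- The class of a concatenation `transAt i f h` is `cls h * cls f` (Mathlib's
`HomotopyGroup.mul_spec`, reoriented). [folklore] -/
lemma cls_transAt [NeZero N] (i : Fin N) (f h : Ω^ (Fin N) X x) :
    cls (GenLoop.transAt i f h) = cls h * cls f :=
  (HomotopyGroup.mul_spec (i := i)).symm

/-- The class of a reversal `symmAt i f` is `(cls f)⁻¹` (Mathlib's `HomotopyGroup.inv_spec`,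
reoriented). [folklore] -/
lemma cls_symmAt [NeZero N] (i : Fin N) (f : Ω^ (Fin N) X x) : cls (GenLoop.symmAt i f) = (cls f)⁻¹ :=
  (HomotopyGroup.inv_spec (i := i)).symm

/-- The class of the constant loop is `1`. [folklore] -/
lemma cls_const [NeZero N] : cls (GenLoop.const : Ω^ (Fin N) X x) = 1 := rfl

/-- **The class `[g ∘ ι_{j,ε}] ∈ π_N(X, x)` of a face** of a cube constant on the codimension-two
skeleton. [folklore] -/
def faceClass (g : C(Fin (N + 1) → I, X)) (hg : IsSkelConst x g) (j : Fin (N + 1)) (ε : I)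
    (hε : IsExtreme ε) : HomotopyGroup (Fin N) X x :=
  cls (faceLoop g hg j ε hε)

/-- `faceClass` is the class of `faceLoop`. [folklore] -/
lemma faceClass_eq (g : C(Fin (N + 1) → I, X)) (hg : IsSkelConst x g) (j : Fin (N + 1)) (ε : I)
    (hε : IsExtreme ε) : faceClass g hg j ε hε = cls (faceLoop g hg j ε hε) := rfl

/-- Classes of pointwise equal faces agree. [folklore] -/
lemma faceClass_congr {g g' : C(Fin (N + 1) → I, X)} (hg : IsSkelConst x g) (hg' : IsSkelConst x g')
    {j : Fin (N + 1)} {ε : I} (hε : IsExtreme ε)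
    (h : ∀ t, g' (Fin.insertNth j ε t) = g (Fin.insertNth j ε t)) :
    faceClass g' hg' j ε hε = faceClass g hg j ε hε :=
  congrArg cls (genLoop_eq_of_forall fun t => by rw [faceLoop_apply, faceLoop_apply, h])

/-- A face which is constant `= x` has trivial class. [folklore] -/
lemma faceClass_eq_one_of_forall [NeZero N] {g : C(Fin (N + 1) → I, X)} (hg : IsSkelConst x g)
    {j : Fin (N + 1)} {ε : I} (hε : IsExtreme ε) (h : ∀ t, g (Fin.insertNth j ε t) = x) :
    faceClass g hg j ε hε = 1 := by
  rw [faceClass, ← cls_const]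
  exact congrArg cls (genLoop_eq_of_forall fun t => by rw [faceLoop_apply, h]; rfl)

/-! ### Pair moves and faces -/

/-- **A pair move in the coordinates `j.succAbove a`, `j.succAbove b` of `Iᴺ⁺¹` restricts on the face
`{y_j = ε}` to the pair move in the coordinates `a`, `b` of `Iᴺ`.** [folklore] -/
theorem pairMap_insertNth (j : Fin (N + 1)) {a b : Fin N} (hab : a ≠ b) (θ : I × I → I × I) (ε : I)
    (t : Fin N → I) :
    pairMap (j.succAbove a) (j.succAbove b) θ (Fin.insertNth j ε t) =
      Fin.insertNth j ε (pairMap a b θ t) := by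
  have hab' : j.succAbove a ≠ j.succAbove b := fun h => hab (Fin.succAbove_right_injective h)
  symm
  rw [Fin.insertNth_eq_iff]
  constructor
  · rw [pairMap_apply_of_ne (Fin.ne_succAbove j a) (Fin.ne_succAbove j b), Fin.insertNth_apply_same]
  · funext c
    rw [Fin.removeNth_apply]
    by_cases hcb : c = b
    · subst hcb
      rw [pairMap_apply_snd, pairMap_apply_snd, Fin.insertNth_apply_succAbove,
        Fin.insertNth_apply_succAbove]
    by_cases hca : c = a
    · subst hca
      rw [pairMap_apply_fst hab, pairMap_apply_fst hab', Fin.insertNth_apply_succAbove,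
        Fin.insertNth_apply_succAbove]
    · rw [pairMap_apply_of_ne hca hcb,
        pairMap_apply_of_ne (fun h => hca (Fin.succAbove_right_injective h))
          (fun h => hcb (Fin.succAbove_right_injective h)), Fin.insertNth_apply_succAbove]

/-- A cube precomposed with a continuous self-map of `Iᴺ⁺¹`. [folklore] -/
def precomp (g : C(Fin (N + 1) → I, X)) (m : (Fin (N + 1) → I) → (Fin (N + 1) → I))
    (hm : Continuous m) : C(Fin (N + 1) → I, X) :=
  g.comp ⟨m, hm⟩

/-- `precomp` pointwise. [folklore] -/
@[simp] lemma precomp_apply (g : C(Fin (N + 1) → I, X)) (m : (Fin (N + 1) → I) → (Fin (N + 1) → I))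
    (hm : Continuous m) (y : Fin (N + 1) → I) : precomp g m hm y = g (m y) := rfl

/-- **Faces away from the two moved coordinates keep their class.** For `g` constant on the
codimension-two skeleton, `j ∉ {p, q}` — so that `p = j.succAbove a`, `q = j.succAbove b` — and
`Θ` a boundary-preserving deformation of the square from the identity, the face `{y_j = ε}` of
`g ∘ pairMap p q (Θ 1)` has the same class in `π_N(X, x)` as the face `{y_j = ε}` of `g`.
[folklore] -/
theorem faceClass_precomp_pairMap {g : C(Fin (N + 1) → I, X)} (hg : IsSkelConst x g)
    (j : Fin (N + 1)) {p q : Fin (N + 1)} {a b : Fin N} (hpa : j.succAbove a = p)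
    (hqb : j.succAbove b = q) (hab : a ≠ b) {Θ : I → I × I → I × I}
    (hΘc : Continuous fun q : I × (I × I) => Θ q.1 q.2) (h0 : ∀ p, Θ 0 p = p)
    (hΘb : ∀ t, MapsTo (Θ t) sqBoundary sqBoundary) {ε : I} (hε : IsExtreme ε)
    {hc : Continuous (pairMap p q (Θ 1))} (hg' : IsSkelConst x (precomp g (pairMap p q (Θ 1)) hc)) :
    faceClass _ hg' j ε hε = faceClass g hg j ε hε := by
  subst hpa hqb
  rw [faceClass, faceClass, cls_eq, cls_eq, ← mk_precompPair_eq (faceLoop g hg j ε hε) hab hΘc h0 hΘb]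
  exact congrArg _ (genLoop_eq_of_forall fun t => by
    rw [faceLoop_apply, precomp_apply, pairMap_insertNth j hab, precompPair_apply, faceLoop_apply])

end CubeHAT

end Literature.AlgebraicTopology.Homotopy

end
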